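import Mathlib
import Summits.KontsevichZagierPeriods.Zeta5Search.CatalanTwoAdicSeries
import HarnessLib

/-!
# Catalan box family — the defining series summed in `ℚ₂` has the EXACT norm of its first term (all parameters)

HONEST FRAMING: systematic search; no irrationality claim unless certified.

Cell `pub-zeta5`, family-designer seat `fam-catalan` (`families/catalan/TWOADIC.md` §7, law F13♯).  The Catalan box linear form with
parameters `(h,j,k,l,m)` is the series `J = Σ_{μ ≥ l} t_μ R(μ)` (`families/catalan/FAMILY.md` §1, implementation A), with the Beta weights
`t_μ = B(μ+1,½)` of `CatalanTwoAdicSeries` and the rational function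
`R(μ) = binom(μ−l+s, s) · j! · (½)_k / ((μ+h−l+½)_{j+1} · (μ+l… ` precisely, writing `μ = l + ν`:
`R(l+ν) = binom(ν+s, s) · j! · (½)_k / ((ν+h+½)_{j+1} (l+ν+1+½)_k)`, `s = j+k−m`.
In ℝ the series sums to `Q·G + P` (`G` = Catalan's constant).  Summed in `ℚ₂` instead — it converges there, since `v₂(t_μ) = 2μ+1−s₂(μ)` —
its value `J₂` is what the lane's 2-adic analysis is about (TWOADIC §7–§9: `J₂ = P + ξ·Q`, proved on paper).  THIS FILE PROVES, for ALL
parameters, the valuation law F13♯ for the series itself: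

  `‖J₂(h,j,k,l,m)‖₂ = 2^{−(2(j+l) + 2 − s₂(j) − s₂(l))}`  (`norm_J2`),

i.e. `v₂(J₂) = 2(j+l) + 2 − s₂(j) − s₂(l)` = the valuation of the FIRST term (`ν = 0`); every later term has valuation larger by at least `ν`
(ultrametric "first-term" law).  Ingredients: `padicValRat_two_tB`, `padicValRat_two_tB_lt_succ` (previous file), `v₂((x+½)_N) = −N`
(`padicValRat_two_halfPoch`), Legendre for `j!`, `v₂(binom) ≥ 0`, and `IsUltrametricDist.norm_add_eq_max_of_norm_ne_norm` /
`norm_tsum_le_of_forall_le_of_nonneg` in `ℚ_[2]`.  Nothing here is a statement about `G`, `ξ` or irrationality.  0 sorry.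
-/

open Finset Filter

namespace Summit.KontsevichZagierPeriods.Zeta5Search.CatalanTwoAdicSeries

open Summit.KontsevichZagierPeriods.Zeta5Search.CatalanQSum (padicValNat_two_factorial)

/-! ### Half-integer Pochhammer products `(x+½)_N = (x+½)(x+1+½)⋯(x+N−1+½)` -/

/-- `halfPoch x N = ∏_{i<N} (x + i + ½)` for an integer `x`. -/
def halfPoch (x : ℤ) : ℕ → ℚ
  | 0 => 1
  | N + 1 => halfPoch x N * ((x : ℚ) + N + 1 / 2)

-- (filing-lane edit, announced: the two half-integer lemmas `v₂(y + ½) = −1` and `y + ½ ≠ 0` are the tree's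
-- `CatalanQSum.padicValRat_intCast_add_half` / `CatalanQSum.intCast_add_half_ne_zero`
-- (`CatalanQSumTwoAdicProof.lean`, in the import closure) — reused, not restated.)

/-- The half-integer Pochhammer products never vanish. -/
theorem halfPoch_ne_zero (x : ℤ) : ∀ N : ℕ, halfPoch x N ≠ 0
  | 0 => by simp [halfPoch]
  | N + 1 => by
    rw [halfPoch]
    refine mul_ne_zero (halfPoch_ne_zero x N) ?_
    have := CatalanQSum.intCast_add_half_ne_zero (x + N); push_cast at this; exact this

/-- `v₂((x+½)_N) = −N`. -/
theorem padicValRat_two_halfPoch (x : ℤ) : ∀ N : ℕ, padicValRat 2 (halfPoch x N) = -(N : ℤ)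
  | 0 => by simp [halfPoch]
  | N + 1 => by
    have hf : ((x : ℚ) + N + 1 / 2) ≠ 0 := by
      have := CatalanQSum.intCast_add_half_ne_zero (x + N); push_cast at this; exact this
    rw [halfPoch, padicValRat.mul (halfPoch_ne_zero x N) hf, padicValRat_two_halfPoch x N]
    have := CatalanQSum.padicValRat_intCast_add_half (x + N); push_cast at this; rw [this]
    push_cast; ring

/-! ### The terms of the defining series and their valuations -/

/-- The `ν`-th term (`μ = l + ν`) of the defining series of the Catalan box form with parameters `(h,j,k,l,m)`:
`t_{l+ν} · binom(ν+s, s) · j! · (½)_k / ((ν+h+½)_{j+1} · (l+ν+1+½)_k)`, `s = j+k−m`. -/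
def jTerm (h j k l m : ℕ) (ν : ℕ) : ℚ :=
  tB (l + ν) * ((Nat.choose (ν + (j + k - m)) (j + k - m) : ℕ) : ℚ) * (j.factorial : ℚ) * halfPoch 0 k /
    (halfPoch ((ν : ℤ) + h) (j + 1) * halfPoch ((l : ℤ) + ν + 1) k)

/-- The predicted valuation: `v₀ = 2(j+l) + 2 − s₂(j) − s₂(l)`. -/
def v0 (j l : ℕ) : ℤ := 2 * ((j : ℤ) + l) + 2 - ((Nat.digits 2 j).sum : ℤ) - ((Nat.digits 2 l).sum : ℤ)

/-- Every term of the series is non-zero. -/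
theorem jTerm_ne_zero (h j k l m ν : ℕ) : jTerm h j k l m ν ≠ 0 := by
  unfold jTerm
  refine div_ne_zero ?_ (mul_ne_zero (halfPoch_ne_zero _ _) (halfPoch_ne_zero _ _))
  refine mul_ne_zero (mul_ne_zero (mul_ne_zero (tB_ne_zero _) ?_) (by positivity)) (halfPoch_ne_zero _ _)
  exact_mod_cast (Nat.choose_pos (by omega)).ne'

/-- Exact valuation of the `ν`-th term. -/
theorem padicValRat_two_jTerm (h j k l m ν : ℕ) :
    padicValRat 2 (jTerm h j k l m ν) =
      padicValRat 2 (tB (l + ν)) + (padicValNat 2 (Nat.choose (ν + (j + k - m)) (j + k - m)) : ℤ)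
        + ((j : ℤ) - ((Nat.digits 2 j).sum : ℤ)) + (j + 1) := by
  unfold jTerm
  have hC : (((Nat.choose (ν + (j + k - m)) (j + k - m)) : ℕ) : ℚ) ≠ 0 := by
    exact_mod_cast (Nat.choose_pos (by omega)).ne'
  have hj : (j.factorial : ℚ) ≠ 0 := by positivity
  rw [padicValRat.div (mul_ne_zero (mul_ne_zero (mul_ne_zero (tB_ne_zero _) hC) hj) (halfPoch_ne_zero _ _))
      (mul_ne_zero (halfPoch_ne_zero _ _) (halfPoch_ne_zero _ _)),
    padicValRat.mul (mul_ne_zero (mul_ne_zero (tB_ne_zero _) hC) hj) (halfPoch_ne_zero _ _),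
    padicValRat.mul (mul_ne_zero (tB_ne_zero _) hC) hj, padicValRat.mul (tB_ne_zero _) hC,
    padicValRat.mul (halfPoch_ne_zero _ _) (halfPoch_ne_zero _ _),
    padicValRat_two_halfPoch, padicValRat_two_halfPoch, padicValRat_two_halfPoch, padicValRat.of_nat,
    padicValRat.of_nat, padicValNat_two_factorial]
  push_cast
  ring

/-- The first term has valuation exactly `v₀`. -/
theorem padicValRat_two_jTerm_zero (h j k l m : ℕ) : padicValRat 2 (jTerm h j k l m 0) = v0 j l := by
  rw [padicValRat_two_jTerm, padicValRat_two_tB]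
  simp only [zero_add, Nat.choose_self, padicValNat_one_right, Nat.cast_zero, add_zero, v0]
  ring

/-- `v₂(t_{l+ν}) ≥ v₂(t_l) + ν`. -/
theorem padicValRat_two_tB_add (l : ℕ) : ∀ ν : ℕ, padicValRat 2 (tB l) + ν ≤ padicValRat 2 (tB (l + ν))
  | 0 => by simp
  | ν + 1 => by
    have h1 := padicValRat_two_tB_add l ν
    have h2 := padicValRat_two_tB_lt_succ (l + ν)
    rw [show l + (ν + 1) = l + ν + 1 by ring]
    push_cast
    linarith

/-- Every term has valuation at least `v₀ + ν`. -/
theorem padicValRat_two_jTerm_ge (h j k l m ν : ℕ) : v0 j l + ν ≤ padicValRat 2 (jTerm h j k l m ν) := by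
  rw [← padicValRat_two_jTerm_zero h j k l m, padicValRat_two_jTerm, padicValRat_two_jTerm]
  have h1 := padicValRat_two_tB_add l ν
  have h2 : (0 : ℤ) ≤ (padicValNat 2 (Nat.choose (ν + (j + k - m)) (j + k - m)) : ℤ) := by positivity
  simp only [zero_add, Nat.choose_self, padicValNat_one_right, Nat.cast_zero, add_zero]
  linarith

/-! ### Norms in `ℚ₂`, summability, and the first-term law -/

/-- The 2-adic norm of a non-zero rational in terms of `padicValRat`. -/
theorem norm_ratCast_eq (q : ℚ) (hq : q ≠ 0) : ‖((q : ℚ) : ℚ_[2])‖ = (2 : ℝ) ^ (-padicValRat 2 q) := by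
  rw [Padic.eq_padicNorm, padicNorm.eq_zpow_of_nonzero hq]; push_cast; rfl

/-- The 2-adic norm of the first term is `2^{-v₀}`. -/
theorem norm_jTerm_zero (h j k l m : ℕ) : ‖((jTerm h j k l m 0 : ℚ) : ℚ_[2])‖ = (2 : ℝ) ^ (-v0 j l) := by
  rw [norm_ratCast_eq _ (jTerm_ne_zero _ _ _ _ _ _), padicValRat_two_jTerm_zero]

/-- Tail bound: `‖jTerm ν‖₂ ≤ 2^{-v₀}·(1/2)^ν`. -/
theorem norm_jTerm_le (h j k l m ν : ℕ) :
    ‖((jTerm h j k l m ν : ℚ) : ℚ_[2])‖ ≤ (2 : ℝ) ^ (-v0 j l) * ((1 : ℝ) / 2) ^ ν := by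
  rw [norm_ratCast_eq _ (jTerm_ne_zero _ _ _ _ _ _)]
  have hν : ((1 : ℝ) / 2) ^ ν = (2 : ℝ) ^ (-(ν : ℤ)) := by
    rw [zpow_neg, zpow_natCast, one_div, inv_pow]
  rw [hν, ← zpow_add₀ (by norm_num : (2 : ℝ) ≠ 0)]
  exact zpow_le_zpow_right₀ (by norm_num) (by have := padicValRat_two_jTerm_ge h j k l m ν; linarith)

/-- The terms tend to `0` in `ℚ₂`. -/
theorem tendsto_jTerm (h j k l m : ℕ) :
    Tendsto (fun ν => ((jTerm h j k l m ν : ℚ) : ℚ_[2])) atTop (nhds 0) := by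
  rw [tendsto_zero_iff_norm_tendsto_zero]
  have hb : Tendsto (fun ν : ℕ => (2 : ℝ) ^ (-v0 j l) * ((1 : ℝ) / 2) ^ ν) atTop (nhds 0) := by
    have := (tendsto_pow_atTop_nhds_zero_of_lt_one (by norm_num : (0 : ℝ) ≤ 1 / 2) (by norm_num)).const_mul
      ((2 : ℝ) ^ (-v0 j l))
    simpa using this
  exact squeeze_zero (fun ν => norm_nonneg _) (norm_jTerm_le h j k l m) hb

/-- The defining series is summable in `ℚ₂` (all parameters). -/
theorem summable_jTerm (h j k l m : ℕ) : Summable fun ν => ((jTerm h j k l m ν : ℚ) : ℚ_[2]) := by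
  refine NonarchimedeanAddGroup.summable_of_tendsto_cofinite_zero ?_
  rw [Nat.cofinite_eq_atTop]
  exact tendsto_jTerm h j k l m

/-- The Catalan box series with parameters `(h,j,k,l,m)` SUMMED IN `ℚ₂`. -/
noncomputable def J2 (h j k l m : ℕ) : ℚ_[2] := ∑' ν, ((jTerm h j k l m ν : ℚ) : ℚ_[2])

/-- The tail `Σ_{ν≥1}` has norm at most half the first term's. -/
theorem norm_tail_le (h j k l m : ℕ) :
    ‖∑' ν, ((jTerm h j k l m (ν + 1) : ℚ) : ℚ_[2])‖ ≤ (2 : ℝ) ^ (-v0 j l) * (1 / 2) := by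
  refine IsUltrametricDist.norm_tsum_le_of_forall_le_of_nonneg (by positivity) fun ν => ?_
  refine (norm_jTerm_le h j k l m (ν + 1)).trans ?_
  rw [pow_succ]
  have h1 : ((1 : ℝ) / 2) ^ ν ≤ 1 := pow_le_one₀ (by norm_num) (by norm_num)
  have h2 : (0 : ℝ) ≤ (2 : ℝ) ^ (-v0 j l) := by positivity
  nlinarith

/-- **F13♯ for the series (all parameters): the 2-adic norm of `J₂` is exactly that of its first term,**
`‖J₂(h,j,k,l,m)‖₂ = 2^{−(2(j+l)+2−s₂(j)−s₂(l))}`. -/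
theorem norm_J2 (h j k l m : ℕ) : ‖J2 h j k l m‖ = (2 : ℝ) ^ (-v0 j l) := by
  unfold J2
  rw [(summable_jTerm h j k l m).tsum_eq_zero_add]
  have h0 := norm_jTerm_zero h j k l m
  have ht := norm_tail_le h j k l m
  have hpos : (0 : ℝ) < (2 : ℝ) ^ (-v0 j l) := by positivity
  have hne : ‖((jTerm h j k l m 0 : ℚ) : ℚ_[2])‖ ≠ ‖∑' ν, ((jTerm h j k l m (ν + 1) : ℚ) : ℚ_[2])‖ := by
    rw [h0]; intro heq; rw [← heq] at ht; linarith
  rw [IsUltrametricDist.norm_add_eq_max_of_norm_ne_norm hne, h0, max_eq_left]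
  linarith

/-- In particular `J₂ ≠ 0` for all parameters (2-adic non-vanishing is free). -/
theorem J2_ne_zero (h j k l m : ℕ) : J2 h j k l m ≠ 0 := by
  intro h0
  have := norm_J2 h j k l m
  rw [h0, norm_zero] at this
  have hpos : (0 : ℝ) < (2 : ℝ) ^ (-v0 j l) := by positivity
  linarith

/-- On the ray `(1,j,1,j+1,1)·n` of TWOADIC §7–§11 the exponent reads `2(2j+1)n + 2 − s₂(jn) − s₂((j+1)n)`. -/
theorem norm_J2_ray (j n : ℕ) :
    ‖J2 n (j * n) n ((j + 1) * n) n‖ =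
      (2 : ℝ) ^ (-(2 * (2 * (j : ℤ) + 1) * n + 2 - ((Nat.digits 2 (j * n)).sum : ℤ) - ((Nat.digits 2 ((j + 1) * n)).sum : ℤ))) := by
  rw [norm_J2]; congr 1; unfold v0; push_cast; ring

end Summit.KontsevichZagierPeriods.Zeta5Search.CatalanTwoAdicSeries
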